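import Literature.NumberTheory.EllipticCurves.NonvanishingTwistsPrescribedInertOfLocalComponentsProofs
import Literature.NumberTheory.EllipticCurves.NonvanishingTwistsPrescribedInertSimpleZero
import HarnessLib

/-!
# The SIMPLE-ZERO prescribed-inert special cases of Friedberg–Hoffstein's Theorem B are consequences
# of the general class statement `𝒟(ξ; S₀)` (second alternative) and the Modularity Theorem

Companion of `NonvanishingTwistsPrescribedInertOfLocalComponentsProofs.lean` (the central-VALUE
alternative, `w(W) = −1`). `NonvanishingTwistsPrescribedInertSimpleZero.lean` types the two
`w(W) = +1` twins as cite-only named facts: for `W/ℚ` elliptic of root number `+1`, a finite set `S`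
of multiplicative primes of even cardinality (resp. `S` and a finite set `C` of primes with `q² ∥ N_W`),
imaginary quadratic fields `K` beyond every bound with `S` (`∪ C`) INERT, the other primes of `N_W`
SPLIT, `2` split if `2 ∤ N_W` (resp. and a good prime `p` split), and a SIMPLE zero of
`L(W^{(d_K)}, s)` at `s = 1` — Friedberg–Hoffstein 1995 Thm. B, second alternative ("there are
infinitely many `χ` such that `L(s, χ ⊗ π)` has a simple zero at `s = 1/2`", Zbl 0847.11026; the
class `𝒟(ξ; S₀)` verbatim in Diaconu–Tian, Ann. of Math. 162 (2005) §2.2), in the inert setting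
(H) of Jetchev–Skinner–Wan 2017 §4.1 ("`ε(π,𝒦,1/2) = −1`", p. 17). Here both are PROVED from the
tree's general rendering `friedbergHoffstein_exists_twist_prescribedLocalComponents` (alternative
(ii)) and `exists_isNewformOf`:

* `rootNumber_quadraticTwist_discr_eq_neg_of_inert_split` — on the Jetchev–Skinner–Wan ∕
  Kohen–Pacetti class (`S` multiplicative of even size and `C` of conductor exponent two inert, the
  rest of `N_W` split) **`w(W^{(d_K)}) = −w(W)`**, either sign (the sibling's
  `rootNumber_quadraticTwist_discr_of_inert_split` with `Σ_{ℓ ∈ S ∪ C} v_ℓ(N_W) = #S + 2#C` even);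
* `friedbergHoffstein_exists_twist_simpleZero_inertAt_sq_splitTwo_of_prescribedLocalComponents`,
  `friedbergHoffstein_exists_twist_simpleZero_inertAt_splitAt_of_prescribedLocalComponents` — seed
  field by `Quadratic.exists_imaginaryQuadratic_split_inert`, sign `−1`, Thm. B (ii) on the class,
  transfer of local types (`inert_of_isLocalSquare_mul`, `split_of_isLocalSquare_mul`).

Everything here is PROVED; no definition and no named fact is introduced (D-0026).

## References

* [FriedbergHoffstein1995] Ann. of Math. 142 (1995) 385–423, Thm. B, second alternative (text not
  held, acq-00930 cite-only; statement via Zbl 0847.11026 and Diaconu–Tian 2005 §2.2).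
* [DiaconuTian2005] Ann. of Math. 162 (2005), §2.2 (p. 1357) — the class `𝒟(ξ; S₀)`.
* [JetchevSkinnerWan2017] Camb. J. Math. 5 (2017), §4.1 (p. 17), §7.4.2 (p. 31).
* [MurtyMurty1997] Ch. 6 §1 — `w(E^{(D)}) = χ_D(−N) w(E)`.
-/

noncomputable section

open scoped Classical NumberTheorySymbols

open WeierstrassCurve NumberField

namespace Literature.NumberTheory.EllipticCurves

open Literature.NumberTheory.EllipticCurves.ModularForms Literature.NumberTheory.QuadraticFields

variable (W : WeierstrassCurve ℚ) [W.IsElliptic]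

/-- **`w(W^{(d_K)}) = −w(W)` on the Jetchev–Skinner–Wan ∕ Kohen–Pacetti class, either sign**: for
`S` a finite set of multiplicative primes of EVEN cardinality and `C` a finite set of primes with
`q² ∥ N_W`, all inert in the imaginary quadratic `K`, and the other primes of `N_W` split,
`w(W^{(d_K)}) = χ_{d_K}(−N_W)·w(W) = −(−1)^{#S + 2#C}·w(W) = −w(W)` (Murty–Murty Ch. 6 §1 with
`(d_K, N_W) = 1`; JSW 2017 §4.1 p. 17 "`ε(π,𝒦,1/2) = −1`"). From `exists_isNewformOf` via the
sibling's `rootNumber_quadraticTwist_discr_of_inert_split`.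
[cite: JetchevSkinnerWan2017, §4.1 p. 17 (ε(π,𝒦,1/2) = −1 under (H))] [cite: MurtyMurty1997, Ch. 6 §1] -/
theorem rootNumber_quadraticTwist_discr_eq_neg_of_inert_split (hmod : exists_isNewformOf)
    (S C : Finset ℕ)
    (hSm : ∀ ℓ ∈ S, ∃ _ : Fact ℓ.Prime, W.HasMultiplicativeReductionAtPrime ℓ) (hSeven : Even S.card)
    (hC : ∀ q ∈ C, ∃ _ : Fact q.Prime, q ^ 2 ∣ W.conductorNorm ℤ ∧ ¬ q ^ 3 ∣ W.conductorNorm ℤ)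
    {K : Type*} [Field K] [NumberField K] (hK : IsImaginaryQuadratic K)
    (hin : ∀ ℓ ∈ S ∪ C, ((Ideal.span {(ℓ : ℤ)}).primesOver (𝓞 K)).ncard = 1 ∧
      ¬ (ℓ : ℤ) ∣ NumberField.discr K)
    (hsplit : ∀ ℓ : ℕ, ℓ.Prime → ℓ ∣ W.conductorNorm ℤ → ℓ ∉ S → ℓ ∉ C →
      ((Ideal.span {(ℓ : ℤ)}).primesOver (𝓞 K)).ncard = 2) :
    (W.quadraticTwist (NumberField.discr K : ℚ)).rootNumber = -W.rootNumber := by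
  set N := W.conductorNorm ℤ with hN
  have hN0 : N ≠ 0 := (W.conductorNorm_pos_holds).ne'
  have hvS : ∀ ℓ ∈ S, N.factorization ℓ = 1 := fun ℓ hℓ ↦ by
    obtain ⟨hF, hm⟩ := hSm ℓ hℓ
    exact W.factorization_conductorNorm_eq_one_of_hasMultiplicativeReductionAtPrime ℓ hm
  have hvC : ∀ q ∈ C, N.factorization q = 2 := fun q hq ↦ by
    obtain ⟨hF, h2, h3⟩ := hC q hq
    have hq := hF.out
    have hle : 2 ≤ N.factorization q := (hq.pow_dvd_iff_le_factorization hN0).mp h2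
    have hlt : ¬ 3 ≤ N.factorization q := fun h ↦ h3 ((hq.pow_dvd_iff_le_factorization hN0).mpr h)
    omega
  have hdisj : Disjoint S C := by
    rw [Finset.disjoint_left]
    intro ℓ hℓS hℓC
    have h1 := hvS ℓ hℓS
    rw [hvC ℓ hℓC] at h1
    exact absurd h1 (by decide)
  have hprime : ∀ ℓ ∈ S ∪ C, ℓ.Prime := fun ℓ hℓ ↦ by
    rcases Finset.mem_union.mp hℓ with h | h
    · obtain ⟨hF, -⟩ := hSm ℓ h; exact hF.out
    · obtain ⟨hF, -⟩ := hC ℓ h; exact hF.out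
  have hS' : ∀ ℓ ∈ S ∪ C, ℓ.Prime ∧ ((Ideal.span {(ℓ : ℤ)}).primesOver (𝓞 K)).ncard = 1 ∧
      ¬ (ℓ : ℤ) ∣ NumberField.discr K := fun ℓ hℓ ↦ ⟨hprime ℓ hℓ, hin ℓ hℓ⟩
  have hsplit' : ∀ ℓ : ℕ, ℓ.Prime → ℓ ∣ W.conductorNorm ℤ → ℓ ∉ S ∪ C →
      ((Ideal.span {(ℓ : ℤ)}).primesOver (𝓞 K)).ncard = 2 := fun ℓ hℓ hℓN hℓSC ↦
    hsplit ℓ hℓ hℓN (fun h ↦ hℓSC (Finset.mem_union_left _ h)) (fun h ↦ hℓSC (Finset.mem_union_right _ h))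
  rw [rootNumber_quadraticTwist_discr_of_inert_split W hmod hK (S ∪ C) hS' hsplit',
    Finset.sum_union hdisj, Finset.sum_congr rfl hvS, Finset.sum_congr rfl hvC]
  simp only [Finset.sum_const, smul_eq_mul, mul_one]
  have hev : Even (S.card + C.card * 2) := hSeven.add (even_two.mul_left _)
  rw [hev.neg_one_pow]
  ring

/-- **`friedbergHoffstein_exists_twist_simpleZero_inertAt_sq_splitTwo` from Thm. B (ii) on a class and
the Modularity Theorem**: for `w(W) = +1` the class of the Cartan seed (`S ∪ C` inert,
`({2} ∪ {ℓ ∣ N_W}) ∖ (S ∪ C)` split; `Quadratic.exists_imaginaryQuadratic_split_inert`) has sign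
`w(W^{(d_{K₀})}) = −1` (`rootNumber_quadraticTwist_discr_eq_neg_of_inert_split`), so Thm. B's second
alternative (`friedbergHoffstein_exists_twist_prescribedLocalComponents`, (ii)) yields fields beyond
every bound in the class with a simple zero; the local types transfer along `d_K d_{K₀} ∈ ℚ_ℓ^{×2}`.
[cite: FriedbergHoffstein1995, Thm. B, second alternative]
[cite: DiaconuTian2005, §2.2 (p. 1357)] [cite: JetchevSkinnerWan2017, §7.4.2 (c) and §4.1 p. 17] -/
theorem friedbergHoffstein_exists_twist_simpleZero_inertAt_sq_splitTwo_of_prescribedLocalComponents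
    (h : friedbergHoffstein_exists_twist_prescribedLocalComponents) (hmod : exists_isNewformOf) :
    friedbergHoffstein_exists_twist_simpleZero_inertAt_sq_splitTwo := by
  intro W _ hw S C hS hSeven hC B
  set N := W.conductorNorm ℤ with hN
  have hN0 : N ≠ 0 := (W.conductorNorm_pos_holds).ne'
  have hSCp : ∀ ℓ ∈ S ∪ C, ℓ.Prime := fun ℓ hℓ ↦ by
    rcases Finset.mem_union.mp hℓ with h' | h'
    · obtain ⟨hF, -⟩ := hS ℓ h'; exact hF.out
    · obtain ⟨hF, -⟩ := hC ℓ h'; exact hF.out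
  have hSdvd : ∀ ℓ ∈ S, ℓ ∣ N := fun ℓ hℓ ↦ by
    obtain ⟨hF, hm⟩ := hS ℓ hℓ
    have h1 : N.factorization ℓ = 1 :=
      W.factorization_conductorNorm_eq_one_of_hasMultiplicativeReductionAtPrime ℓ hm
    exact Nat.dvd_of_factorization_pos (by rw [h1]; exact one_ne_zero)
  have hCdvd : ∀ q ∈ C, q ∣ N := fun q hq ↦ by
    obtain ⟨-, h2, -⟩ := hC q hq
    exact (dvd_pow_self q two_ne_zero).trans h2
  set T : Finset ℕ := (insert 2 N.primeFactors) \ (S ∪ C) with hT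
  have hTp : ∀ p ∈ T, p.Prime := fun p hp ↦ by
    obtain ⟨hp, -⟩ := Finset.mem_sdiff.mp hp
    rcases Finset.mem_insert.mp hp with rfl | h'
    · exact Nat.prime_two
    · exact Nat.prime_of_mem_primeFactors h'
  have hTS : Disjoint T (S ∪ C) := Finset.sdiff_disjoint
  have hmemT : ∀ ℓ : ℕ, ℓ.Prime → (ℓ ∣ N ∨ ℓ = 2) → ℓ ∉ S → ℓ ∉ C → ℓ ∈ T := by
    intro ℓ hℓ hdvd hℓS hℓC
    refine Finset.mem_sdiff.mpr ⟨?_, fun h' ↦ ?_⟩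
    · rcases hdvd with h' | rfl
      · exact Finset.mem_insert_of_mem (Nat.mem_primeFactors.mpr ⟨hℓ, h', hN0⟩)
      · exact Finset.mem_insert_self _ _
    · rcases Finset.mem_union.mp h' with h'' | h''
      · exact hℓS h''
      · exact hℓC h''
  -- (1) the seed field
  obtain ⟨r, K₀, iF₀, iN₀, hr, -, -, -, -, h2₀, hdisc₀, hTsplit₀, hSCinert₀, -⟩ :=
    Quadratic.exists_imaginaryQuadratic_split_inert T (S ∪ C) hTp hSCp hTS 0
  have hK₀ : IsImaginaryQuadratic K₀ :=
    ⟨h2₀, Quadratic.isTotallyComplex_of_discr_neg h2₀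
      (by rw [hdisc₀, neg_lt_zero]; exact_mod_cast hr.pos)⟩
  -- (2) the sign on the class: `w(W^{(d_{K₀})}) = −w(W) = −1`
  have hin₀ : ∀ ℓ ∈ S ∪ C, ((Ideal.span {(ℓ : ℤ)}).primesOver (𝓞 K₀)).ncard = 1 ∧
      ¬ (ℓ : ℤ) ∣ NumberField.discr K₀ := fun ℓ hℓ ↦
    ⟨(hSCinert₀ ℓ hℓ).2, (hSCinert₀ ℓ hℓ).1⟩
  have hsplit₀ : ∀ ℓ : ℕ, ℓ.Prime → ℓ ∣ W.conductorNorm ℤ → ℓ ∉ S → ℓ ∉ C →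
      ((Ideal.span {(ℓ : ℤ)}).primesOver (𝓞 K₀)).ncard = 2 :=
    fun ℓ hℓ hℓN hℓS hℓC ↦ (hTsplit₀ ℓ (hmemT ℓ hℓ (Or.inl hℓN) hℓS hℓC)).2
  have hsign : (W.quadraticTwist (NumberField.discr K₀ : ℚ)).rootNumber = -1 := by
    rw [rootNumber_quadraticTwist_discr_eq_neg_of_inert_split W hmod S C hS hSeven hC hK₀ hin₀ hsplit₀,
      hw]
  -- (3) Thm. B (ii) on the class of `K₀` at `S₀ = T ∪ (S ∪ C)`
  have hS₀N : ∀ ℓ : ℕ, ℓ.Prime → ℓ ∣ W.conductorNorm ℤ → ℓ ∈ T ∪ (S ∪ C) := fun ℓ hℓ hℓN ↦ by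
    by_cases hℓSC : ℓ ∈ S ∪ C
    · exact Finset.mem_union_right _ hℓSC
    · exact Finset.mem_union_left _ (hmemT ℓ hℓ (Or.inl hℓN)
        (fun h' ↦ hℓSC (Finset.mem_union_left _ h')) (fun h' ↦ hℓSC (Finset.mem_union_right _ h')))
  obtain ⟨K, iF, iN, hK, hB, hagree, hL0, hL1⟩ := (h W (T ∪ (S ∪ C)) K₀ hK₀ hS₀N B).2 hsign
  have h2 := hK.1
  -- (4) transfer
  refine ⟨K, iF, iN, hK, hB, fun ℓ hℓSC ↦ ?_, fun ℓ hℓ hℓN hℓS hℓC ↦ ?_, fun h2N ↦ ?_, hL0, hL1⟩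
  · obtain ⟨hnd₀, hone₀⟩ := hSCinert₀ ℓ hℓSC
    exact inert_of_isLocalSquare_mul h2₀ h2 (hSCp ℓ hℓSC) hone₀ hnd₀
      (hagree ℓ (Finset.mem_union_right _ hℓSC) (hSCp ℓ hℓSC))
  · have hℓT := hmemT ℓ hℓ (Or.inl hℓN) hℓS hℓC
    exact split_of_isLocalSquare_mul h2₀ h2 hℓ (hTsplit₀ ℓ hℓT).2
      (hagree ℓ (Finset.mem_union_left _ hℓT) hℓ)
  · have h2S : 2 ∉ S := fun h' ↦ h2N (hSdvd 2 h')
    have h2C : 2 ∉ C := fun h' ↦ h2N (hCdvd 2 h')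
    have h2T := hmemT 2 Nat.prime_two (Or.inr rfl) h2S h2C
    have := split_of_isLocalSquare_mul h2₀ h2 Nat.prime_two (hTsplit₀ 2 h2T).2
      (hagree 2 (Finset.mem_union_left _ h2T) Nat.prime_two)
    exact_mod_cast this

/-- **`friedbergHoffstein_exists_twist_simpleZero_inertAt_splitAt` from Thm. B (ii) on a class and the
Modularity Theorem** (Jetchev–Skinner–Wan's `K″`-type field for a root-number-`+1` curve: `S` inert,
the other primes of `N_W` split, `2` split if `2 ∤ N_W`, the good prime `p` split, simple zero): seed
with split set `({2, p} ∪ {ℓ ∣ N_W}) ∖ S` (the good prime `p` is not in `S`: multiplicative excludes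
good, Mathlib `HasMultiplicativeReduction.not_hasGoodReduction`), sign `−1`
(`rootNumber_quadraticTwist_discr_eq_neg_of_inert_split` at `C = ∅`), Thm. B (ii) at
`S₀ = {2, p} ∪ {ℓ ∣ N_W} ∪ S`, transfer. The scoping clause `S.Nonempty` of the fact is not used.
[cite: FriedbergHoffstein1995, Thm. B, second alternative]
[cite: JetchevSkinnerWan2017, §4.1 (H) p. 17 and §7.4.2 (p. 31)] [cite: DiaconuTian2005, §2.2 (p. 1357)] -/
theorem friedbergHoffstein_exists_twist_simpleZero_inertAt_splitAt_of_prescribedLocalComponents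
    (h : friedbergHoffstein_exists_twist_prescribedLocalComponents) (hmod : exists_isNewformOf) :
    friedbergHoffstein_exists_twist_simpleZero_inertAt_splitAt := by
  intro W _ hw S hS hSeven _ p _ hgood B
  set N := W.conductorNorm ℤ with hN
  have hN0 : N ≠ 0 := (W.conductorNorm_pos_holds).ne'
  have hp : p.Prime := Fact.out
  have hSp : ∀ ℓ ∈ S, ℓ.Prime := fun ℓ hℓ ↦ by
    obtain ⟨hF, -⟩ := hS ℓ hℓ
    exact hF.out
  have hSdvd : ∀ ℓ ∈ S, ℓ ∣ N := fun ℓ hℓ ↦ by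
    obtain ⟨hF, hm⟩ := hS ℓ hℓ
    have h1 : N.factorization ℓ = 1 :=
      W.factorization_conductorNorm_eq_one_of_hasMultiplicativeReductionAtPrime ℓ hm
    exact Nat.dvd_of_factorization_pos (by rw [h1]; exact one_ne_zero)
  -- the good prime `p` is not in the multiplicative set `S`
  have hpS : p ∉ S := fun hpS ↦ by
    obtain ⟨hF, hm⟩ := hS p hpS
    exact (WeierstrassCurve.HasMultiplicativeReduction.not_hasGoodReduction (R := ℤ_[p]) hm) hgood
  set T : Finset ℕ := (insert 2 (insert p N.primeFactors)) \ S with hT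
  have hTp : ∀ q ∈ T, q.Prime := fun q hq ↦ by
    obtain ⟨hq, -⟩ := Finset.mem_sdiff.mp hq
    rcases Finset.mem_insert.mp hq with rfl | hq
    · exact Nat.prime_two
    rcases Finset.mem_insert.mp hq with rfl | hq
    · exact hp
    · exact Nat.prime_of_mem_primeFactors hq
  have hTS : Disjoint T S := Finset.sdiff_disjoint
  have hmemT : ∀ ℓ : ℕ, ℓ.Prime → (ℓ ∣ N ∨ ℓ = 2 ∨ ℓ = p) → ℓ ∉ S → ℓ ∈ T := by
    intro ℓ hℓ hdvd hℓS
    refine Finset.mem_sdiff.mpr ⟨?_, hℓS⟩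
    rcases hdvd with h' | rfl | rfl
    · exact Finset.mem_insert_of_mem (Finset.mem_insert_of_mem (Nat.mem_primeFactors.mpr ⟨hℓ, h', hN0⟩))
    · exact Finset.mem_insert_self _ _
    · exact Finset.mem_insert_of_mem (Finset.mem_insert_self _ _)
  -- (1) the seed field
  obtain ⟨r, K₀, iF₀, iN₀, hr, -, -, -, -, h2₀, hdisc₀, hTsplit₀, hSinert₀, -⟩ :=
    Quadratic.exists_imaginaryQuadratic_split_inert T S hTp hSp hTS 0
  have hK₀ : IsImaginaryQuadratic K₀ :=
    ⟨h2₀, Quadratic.isTotallyComplex_of_discr_neg h2₀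
      (by rw [hdisc₀, neg_lt_zero]; exact_mod_cast hr.pos)⟩
  -- (2) the sign on the class
  have hin₀ : ∀ ℓ ∈ S ∪ ∅, ((Ideal.span {(ℓ : ℤ)}).primesOver (𝓞 K₀)).ncard = 1 ∧
      ¬ (ℓ : ℤ) ∣ NumberField.discr K₀ := fun ℓ hℓ ↦ by
    rw [Finset.union_empty] at hℓ
    exact ⟨(hSinert₀ ℓ hℓ).2, (hSinert₀ ℓ hℓ).1⟩
  have hsplit₀ : ∀ ℓ : ℕ, ℓ.Prime → ℓ ∣ W.conductorNorm ℤ → ℓ ∉ S → ℓ ∉ (∅ : Finset ℕ) →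
      ((Ideal.span {(ℓ : ℤ)}).primesOver (𝓞 K₀)).ncard = 2 :=
    fun ℓ hℓ hℓN hℓS _ ↦ (hTsplit₀ ℓ (hmemT ℓ hℓ (Or.inl hℓN) hℓS)).2
  have hsign : (W.quadraticTwist (NumberField.discr K₀ : ℚ)).rootNumber = -1 := by
    rw [rootNumber_quadraticTwist_discr_eq_neg_of_inert_split W hmod S ∅ hS hSeven
      (fun q hq ↦ absurd hq (Finset.notMem_empty q)) hK₀ hin₀ hsplit₀, hw]
  -- (3) Thm. B (ii) on the class of `K₀` at `S₀ = T ∪ S`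
  have hS₀N : ∀ ℓ : ℕ, ℓ.Prime → ℓ ∣ W.conductorNorm ℤ → ℓ ∈ T ∪ S := fun ℓ hℓ hℓN ↦ by
    by_cases hℓS : ℓ ∈ S
    · exact Finset.mem_union_right _ hℓS
    · exact Finset.mem_union_left _ (hmemT ℓ hℓ (Or.inl hℓN) hℓS)
  obtain ⟨K, iF, iN, hK, hB, hagree, hL0, hL1⟩ := (h W (T ∪ S) K₀ hK₀ hS₀N B).2 hsign
  have h2 := hK.1
  -- (4) transfer
  refine ⟨K, iF, iN, hK, hB, fun ℓ hℓS ↦ ?_, fun ℓ hℓ hℓN hℓS ↦ ?_, fun h2N ↦ ?_,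
    fun q hq hqp ↦ ?_, hL0, hL1⟩
  · obtain ⟨hnd₀, hone₀⟩ := hSinert₀ ℓ hℓS
    exact inert_of_isLocalSquare_mul h2₀ h2 (hSp ℓ hℓS) hone₀ hnd₀
      (hagree ℓ (Finset.mem_union_right _ hℓS) (hSp ℓ hℓS))
  · have hℓT := hmemT ℓ hℓ (Or.inl hℓN) hℓS
    exact split_of_isLocalSquare_mul h2₀ h2 hℓ (hTsplit₀ ℓ hℓT).2
      (hagree ℓ (Finset.mem_union_left _ hℓT) hℓ)
  · have h2S : 2 ∉ S := fun h' ↦ h2N (hSdvd 2 h')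
    have h2T := hmemT 2 Nat.prime_two (Or.inr (Or.inl rfl)) h2S
    have := split_of_isLocalSquare_mul h2₀ h2 Nat.prime_two (hTsplit₀ 2 h2T).2
      (hagree 2 (Finset.mem_union_left _ h2T) Nat.prime_two)
    exact_mod_cast this
  · obtain rfl : q = p := (Nat.prime_dvd_prime_iff_eq hq hp).mp hqp
    have hqT := hmemT q hq (Or.inr (Or.inr rfl)) hpS
    exact split_of_isLocalSquare_mul h2₀ h2 hq (hTsplit₀ q hqT).2
      (hagree q (Finset.mem_union_left _ hqT) hq)

end Literature.NumberTheory.EllipticCurves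

end
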